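import Mathlib
import Summits.Ventures.FusionMHD.Bench.BallooningSAlphaWitnessS05Band
import Summits.Ventures.FusionMHD.Bench.BallooningSAlphaWitnessS075Band
import Summits.Ventures.FusionMHD.Bench.BallooningSAlphaWitness25Band
import Summits.Ventures.FusionMHD.Bench.BallooningSAlphaWitnessS125Band
import Summits.Ventures.FusionMHD.Bench.BallooningSAlphaWitnessS15Band
import Summits.Ventures.FusionMHD.Bench.BallooningSAlphaWitnessS2Band
import Summits.Ventures.FusionMHD.Bench.BallooningSAlphaWitnessS25Band
import Summits.Ventures.FusionMHD.Bench.BallooningSAlphaWitnessS3Band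
import Summits.Ventures.FusionMHD.Models.SAlphaTwoTurnLens
import HarnessLib

/-!
# F3 — THE UNSTABLE BANDS OF THE `s–α` MODEL AT THE EIGHT SHEARS OF THE LADDER, CERTIFIED UP TO THE SECOND-STABILITY EDGE: at
# `s = 1/2, 3/4, 1, 5/4, 3/2, 2, 5/2, 3` every `α` of an explicit interval `[a_s, b_s]` carries an instability witness, with `b_s` within
# `0.02` of the (float) SECOND edge `α₂(s)`; joined with model-7's two-turn lens the certified unstable set at each shear is ONE interval
# `[lensLo s, b_s]` (`[31/50, 129/50]` at `s = 1`)
(venture LADDER-GRIDFUSION, rung F3; cell `gridfusion`, typed by gridfusion-lit-3 (g14), 2026-08-28.  ONE composition file over the seven band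
files `BallooningSAlphaWitnessS05Band … S3Band` (this seat), `BallooningSAlphaWitness25Band` (`s = 1`, this seat) and model-7 g9's
`Models/SAlphaTwoTurnLens` BY NAME; 0 `def … : Prop` facts, 0 defs, 0 kit, no `decide`, no `native_decide`, no floating point in any statement.)

## THREE COLUMNS
CERTIFIED (kernel): in the `s–α` ballooning MODEL (Freidberg (12.96)–(12.99), `Λ = sθ − α sin θ`, `θ₀ = 0`), writing `U_s` for the set of
`α` at which SOME window carries a differentiable trial function vanishing at its ends with negative one-surface energy (12.38)/(12.97):
* `unstable_bands` (lit-3 alone; at each shear ONE `C²` quintic-spline trial function certified at the two ends of its interval by Taylor-model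
  integral enclosures, convexity in `α` in between; at `s = 1` two functions):
  `U_{1/2} ⊇ [3/5, 5/3]`, `U_{3/4} ⊇ [7/10, 43/20]`, `U_1 ⊇ [31/50, 129/50]`, `U_{5/4} ⊇ [1, 3]`, `U_{3/2} ⊇ [6/5, 17/5]`, `U_2 ⊇ [3/2, 417/100]`,
  `U_{5/2} ⊇ [19/10, 49/10]`, `U_3 ⊇ [9/4, 28/5]`;
* `unstable_from_lensLo` (with model-7's `SAlphaTwoTurnLens.unstableWitness_of_mem_lens`, `lensLo_at_shears` BY NAME — the lens covers
  `[lensLo s, lensHi s]`, `lensHi s = 22/25 + 31s/25`, and every `a_s ≤ lensHi s`):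
  `U_{1/2} ⊇ [1/2, 5/3]`, `U_{3/4} ⊇ [59/100, 43/20]`, `U_1 ⊇ [31/50, 129/50]`, `U_{5/4} ⊇ [331/400, 3]`, `U_{3/2} ⊇ [39/40, 17/5]`,
  `U_2 ⊇ [27/20, 417/100]`, `U_{5/2} ⊇ [7/4, 49/10]`, `U_3 ⊇ [11/5, 28/5]`.
VALIDATED (not in the kernel; lit-3 g14 `edges.py`: RK4 shooting of the even Euler–Lagrange solution, zero on `(0, 100]`, bisection): the
MODEL's band `U_s = (α₁(s), α₂(s))` has `(α₁, α₂) ≈ (0.390, 1.685)` at `s = 1/2`, `(0.492, 2.165)` at `3/4`, `(0.61, 2.604)` at `1`,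
`(0.742, 3.019)` at `5/4`, `(0.881, 3.417)` at `3/2`, `(1.175, 4.178)` at `2`, `(1.486, 4.907)` at `5/2`, `(1.810, 5.614)` at `3`: the certified
upper ends `b_s` lie `0.018, 0.015, 0.02, 0.019, 0.017, 0.008, 0.007, 0.014` below `α₂(s)`; the FIRST edges are bracketed by the cell's
stable-side / witness rows (★ #221, #238, #213′/#240, #237, #227/#228, #231, #246, model-7's `s = 3` chain), not restated here.  PAIRING: any
certified STABLE point `(s, α⁺)` with `α⁺ > b_s` (model-7 g9's announced `(3, 6)`, `Models/SAlphaSecondStableS3A6*`) turns `(b_s, α⁺)` into a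
certified bracket of the SECOND edge; nothing of the kind is imported or assumed here.  MODELLED: `s–α` model (large-aspect-ratio shifted
circles, high-`n` ballooning ordering, `θ₀ = 0`, ideal MHD); «unstable» in the model's own one-surface (Newcomb) sense; representation step
(Connor–Hastie–Taylor 1979) quoted in `BallooningSAlpha.lean`, not typed; no device, no `β`-limit.  Citations: Freidberg 2014 §12.3
(12.38)–(12.40), §12.6.2 (12.97) and the `s–α` diagram Fig. 12.5 / fit (12.100) [Freidberg2014]; Fundamenski 2009 §4 p0171 («the instability
region … the domain of ballooning instabilities» between the first and second stability regions) [Fundamenski2009].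
-/

open Set Real
open Literature.MathematicalPhysics.MHD.Ballooning Literature.MathematicalPhysics.MHD.Ballooning.SAlpha
open Summit.Ventures.FusionMHD.Models

namespace Summit.Ventures.FusionMHD.Bench

namespace SAlphaSecondEdgeBands

/-- ★★ THE EIGHT BANDS (lit-3's spline witnesses alone): at each shear of the ladder every `α` of the stated interval carries an
instability witness of the MODEL. [cite: Freidberg2014, §12.3 eqs. (12.38)–(12.40)] («… The plasma is unstable», band by band) -/
theorem unstable_bands :
    (∀ α ∈ Icc (3/5 : ℝ) (5/3), ∃ a b : ℝ, ∃ X X' : ℝ → ℝ, UnstableWitness (1 / 2) α a b X X') ∧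
    (∀ α ∈ Icc (7/10 : ℝ) (43/20), ∃ a b : ℝ, ∃ X X' : ℝ → ℝ, UnstableWitness (3 / 4) α a b X X') ∧
    (∀ α ∈ Icc (31/50 : ℝ) (129/50), ∃ a b : ℝ, ∃ X X' : ℝ → ℝ, UnstableWitness 1 α a b X X') ∧
    (∀ α ∈ Icc (1 : ℝ) (3), ∃ a b : ℝ, ∃ X X' : ℝ → ℝ, UnstableWitness (5 / 4) α a b X X') ∧
    (∀ α ∈ Icc (6/5 : ℝ) (17/5), ∃ a b : ℝ, ∃ X X' : ℝ → ℝ, UnstableWitness (3 / 2) α a b X X') ∧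
    (∀ α ∈ Icc (3/2 : ℝ) (417/100), ∃ a b : ℝ, ∃ X X' : ℝ → ℝ, UnstableWitness 2 α a b X X') ∧
    (∀ α ∈ Icc (19/10 : ℝ) (49/10), ∃ a b : ℝ, ∃ X X' : ℝ → ℝ, UnstableWitness (5 / 2) α a b X X') ∧
    (∀ α ∈ Icc (9/4 : ℝ) (28/5), ∃ a b : ℝ, ∃ X X' : ℝ → ℝ, UnstableWitness 3 α a b X X') :=
  ⟨fun _ h => SAlphaS05W157.exists_unstableWitness_of_mem_band h, fun _ h => SAlphaS075W205.exists_unstableWitness_of_mem_band h, fun _ h => SAlphaW25.unstable_band_unit_shear h, fun _ h => SAlphaS125W29.exists_unstableWitness_of_mem_band h, fun _ h => SAlphaS15W33.exists_unstableWitness_of_mem_band h, fun _ h => SAlphaS2W405.exists_unstableWitness_of_mem_band h, fun _ h => SAlphaS25W48.exists_unstableWitness_of_mem_band h,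
    fun _ h => SAlphaS3W55.exists_unstableWitness_of_mem_band h⟩

/-- `s = 1/2`: `U_s ⊇ [lensLo s, 5/3] = [1/2, 5/3]` — model-7's lens up to `lensHi s`, lit-3's spline band beyond.
[cite: Freidberg2014, §12.3 eqs. (12.38)–(12.40)] -/
theorem unstable_from_lensLo_half {α : ℝ} (h1 : (1/2 : ℝ) ≤ α) (h2 : α ≤ 5/3) : ∃ a b : ℝ, ∃ X X' : ℝ → ℝ, UnstableWitness (1 / 2) α a b X X' := by
  by_cases h : α ≤ SAlphaTwoTurnLens.lensHi (1 / 2)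
  · obtain ⟨hL, _, _, _, _, _, _, _⟩ := SAlphaTwoTurnLens.lensLo_at_shears
    have h1' : SAlphaTwoTurnLens.lensLo (1 / 2) ≤ α := by rw [hL]; exact h1
    exact ⟨_, _, _, _, SAlphaTwoTurnLens.unstableWitness_of_mem_lens (by norm_num) (by norm_num) h1' h⟩
  · have h' : (3/5 : ℝ) ≤ α := by
      have := not_le.mp h
      unfold SAlphaTwoTurnLens.lensHi at this
      linarith
    exact SAlphaS05W157.exists_unstableWitness_of_mem_band ⟨h', h2⟩

/-- `s = 3/4`: `U_s ⊇ [lensLo s, 43/20] = [59/100, 43/20]` — model-7's lens up to `lensHi s`, lit-3's spline band beyond.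
[cite: Freidberg2014, §12.3 eqs. (12.38)–(12.40)] -/
theorem unstable_from_lensLo_threeQuarters {α : ℝ} (h1 : (59/100 : ℝ) ≤ α) (h2 : α ≤ 43/20) : ∃ a b : ℝ, ∃ X X' : ℝ → ℝ, UnstableWitness (3 / 4) α a b X X' := by
  by_cases h : α ≤ SAlphaTwoTurnLens.lensHi (3 / 4)
  · obtain ⟨_, hL, _, _, _, _, _, _⟩ := SAlphaTwoTurnLens.lensLo_at_shears
    have h1' : SAlphaTwoTurnLens.lensLo (3 / 4) ≤ α := by rw [hL]; exact h1
    exact ⟨_, _, _, _, SAlphaTwoTurnLens.unstableWitness_of_mem_lens (by norm_num) (by norm_num) h1' h⟩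
  · have h' : (7/10 : ℝ) ≤ α := by
      have := not_le.mp h
      unfold SAlphaTwoTurnLens.lensHi at this
      linarith
    exact SAlphaS075W205.exists_unstableWitness_of_mem_band ⟨h', h2⟩

/-- `s = 1`: `U_1 ⊇ [31/50, 129/50]` (lit-3's two bands; `lensLo 1 = 17/25` lies inside). [cite: Freidberg2014, §12.3 eqs. (12.38)–(12.40)] -/
theorem unstable_from_lensLo_one {α : ℝ} (h1 : (31/50 : ℝ) ≤ α) (h2 : α ≤ 129/50) : ∃ a b : ℝ, ∃ X X' : ℝ → ℝ, UnstableWitness 1 α a b X X' :=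
  SAlphaW25.unstable_band_unit_shear ⟨h1, h2⟩

/-- `s = 5/4`: `U_s ⊇ [lensLo s, 3] = [331/400, 3]` — model-7's lens up to `lensHi s`, lit-3's spline band beyond.
[cite: Freidberg2014, §12.3 eqs. (12.38)–(12.40)] -/
theorem unstable_from_lensLo_fiveQuarters {α : ℝ} (h1 : (331/400 : ℝ) ≤ α) (h2 : α ≤ 3) : ∃ a b : ℝ, ∃ X X' : ℝ → ℝ, UnstableWitness (5 / 4) α a b X X' := by
  by_cases h : α ≤ SAlphaTwoTurnLens.lensHi (5 / 4)
  · obtain ⟨_, _, _, hL, _, _, _, _⟩ := SAlphaTwoTurnLens.lensLo_at_shears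
    have h1' : SAlphaTwoTurnLens.lensLo (5 / 4) ≤ α := by rw [hL]; exact h1
    exact ⟨_, _, _, _, SAlphaTwoTurnLens.unstableWitness_of_mem_lens (by norm_num) (by norm_num) h1' h⟩
  · have h' : (1 : ℝ) ≤ α := by
      have := not_le.mp h
      unfold SAlphaTwoTurnLens.lensHi at this
      linarith
    exact SAlphaS125W29.exists_unstableWitness_of_mem_band ⟨h', h2⟩

/-- `s = 3/2`: `U_s ⊇ [lensLo s, 17/5] = [39/40, 17/5]` — model-7's lens up to `lensHi s`, lit-3's spline band beyond.
[cite: Freidberg2014, §12.3 eqs. (12.38)–(12.40)] -/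
theorem unstable_from_lensLo_threeHalves {α : ℝ} (h1 : (39/40 : ℝ) ≤ α) (h2 : α ≤ 17/5) : ∃ a b : ℝ, ∃ X X' : ℝ → ℝ, UnstableWitness (3 / 2) α a b X X' := by
  by_cases h : α ≤ SAlphaTwoTurnLens.lensHi (3 / 2)
  · obtain ⟨_, _, _, _, hL, _, _, _⟩ := SAlphaTwoTurnLens.lensLo_at_shears
    have h1' : SAlphaTwoTurnLens.lensLo (3 / 2) ≤ α := by rw [hL]; exact h1
    exact ⟨_, _, _, _, SAlphaTwoTurnLens.unstableWitness_of_mem_lens (by norm_num) (by norm_num) h1' h⟩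
  · have h' : (6/5 : ℝ) ≤ α := by
      have := not_le.mp h
      unfold SAlphaTwoTurnLens.lensHi at this
      linarith
    exact SAlphaS15W33.exists_unstableWitness_of_mem_band ⟨h', h2⟩

/-- `s = 2`: `U_s ⊇ [lensLo s, 417/100] = [27/20, 417/100]` — model-7's lens up to `lensHi s`, lit-3's spline band beyond.
[cite: Freidberg2014, §12.3 eqs. (12.38)–(12.40)] -/
theorem unstable_from_lensLo_two {α : ℝ} (h1 : (27/20 : ℝ) ≤ α) (h2 : α ≤ 417/100) : ∃ a b : ℝ, ∃ X X' : ℝ → ℝ, UnstableWitness 2 α a b X X' := by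
  by_cases h : α ≤ SAlphaTwoTurnLens.lensHi 2
  · obtain ⟨_, _, _, _, _, hL, _, _⟩ := SAlphaTwoTurnLens.lensLo_at_shears
    have h1' : SAlphaTwoTurnLens.lensLo 2 ≤ α := by rw [hL]; exact h1
    exact ⟨_, _, _, _, SAlphaTwoTurnLens.unstableWitness_of_mem_lens (by norm_num) (by norm_num) h1' h⟩
  · have h' : (3/2 : ℝ) ≤ α := by
      have := not_le.mp h
      unfold SAlphaTwoTurnLens.lensHi at this
      linarith
    exact SAlphaS2W405.exists_unstableWitness_of_mem_band ⟨h', h2⟩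

/-- `s = 5/2`: `U_s ⊇ [lensLo s, 49/10] = [7/4, 49/10]` — model-7's lens up to `lensHi s`, lit-3's spline band beyond.
[cite: Freidberg2014, §12.3 eqs. (12.38)–(12.40)] -/
theorem unstable_from_lensLo_fiveHalves {α : ℝ} (h1 : (7/4 : ℝ) ≤ α) (h2 : α ≤ 49/10) : ∃ a b : ℝ, ∃ X X' : ℝ → ℝ, UnstableWitness (5 / 2) α a b X X' := by
  by_cases h : α ≤ SAlphaTwoTurnLens.lensHi (5 / 2)
  · obtain ⟨_, _, _, _, _, _, hL, _⟩ := SAlphaTwoTurnLens.lensLo_at_shears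
    have h1' : SAlphaTwoTurnLens.lensLo (5 / 2) ≤ α := by rw [hL]; exact h1
    exact ⟨_, _, _, _, SAlphaTwoTurnLens.unstableWitness_of_mem_lens (by norm_num) (by norm_num) h1' h⟩
  · have h' : (19/10 : ℝ) ≤ α := by
      have := not_le.mp h
      unfold SAlphaTwoTurnLens.lensHi at this
      linarith
    exact SAlphaS25W48.exists_unstableWitness_of_mem_band ⟨h', h2⟩

/-- `s = 3`: `U_s ⊇ [lensLo s, 28/5] = [11/5, 28/5]` — model-7's lens up to `lensHi s`, lit-3's spline band beyond.
[cite: Freidberg2014, §12.3 eqs. (12.38)–(12.40)] -/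
theorem unstable_from_lensLo_three {α : ℝ} (h1 : (11/5 : ℝ) ≤ α) (h2 : α ≤ 28/5) : ∃ a b : ℝ, ∃ X X' : ℝ → ℝ, UnstableWitness 3 α a b X X' := by
  by_cases h : α ≤ SAlphaTwoTurnLens.lensHi 3
  · obtain ⟨_, _, _, _, _, _, _, hL⟩ := SAlphaTwoTurnLens.lensLo_at_shears
    have h1' : SAlphaTwoTurnLens.lensLo 3 ≤ α := by rw [hL]; exact h1
    exact ⟨_, _, _, _, SAlphaTwoTurnLens.unstableWitness_of_mem_lens (by norm_num) (by norm_num) h1' h⟩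
  · have h' : (9/4 : ℝ) ≤ α := by
      have := not_le.mp h
      unfold SAlphaTwoTurnLens.lensHi at this
      linarith
    exact SAlphaS3W55.exists_unstableWitness_of_mem_band ⟨h', h2⟩

/-- ★★ THE EIGHT INTERVALS `[lensLo s, b_s]` (`[31/50, 129/50]` at `s = 1`): the certified part of the MODEL's unstable band at each shear of
the ladder, from model-7's lower polyline to within `0.02` of the (float) second edge. [cite: Freidberg2014, §12.3 eqs. (12.38)–(12.40)] -/
theorem unstable_from_lensLo :
    (∀ α ∈ Icc (1/2 : ℝ) (5/3), ∃ a b : ℝ, ∃ X X' : ℝ → ℝ, UnstableWitness (1 / 2) α a b X X') ∧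
    (∀ α ∈ Icc (59/100 : ℝ) (43/20), ∃ a b : ℝ, ∃ X X' : ℝ → ℝ, UnstableWitness (3 / 4) α a b X X') ∧
    (∀ α ∈ Icc (31/50 : ℝ) (129/50), ∃ a b : ℝ, ∃ X X' : ℝ → ℝ, UnstableWitness 1 α a b X X') ∧
    (∀ α ∈ Icc (331/400 : ℝ) (3), ∃ a b : ℝ, ∃ X X' : ℝ → ℝ, UnstableWitness (5 / 4) α a b X X') ∧
    (∀ α ∈ Icc (39/40 : ℝ) (17/5), ∃ a b : ℝ, ∃ X X' : ℝ → ℝ, UnstableWitness (3 / 2) α a b X X') ∧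
    (∀ α ∈ Icc (27/20 : ℝ) (417/100), ∃ a b : ℝ, ∃ X X' : ℝ → ℝ, UnstableWitness 2 α a b X X') ∧
    (∀ α ∈ Icc (7/4 : ℝ) (49/10), ∃ a b : ℝ, ∃ X X' : ℝ → ℝ, UnstableWitness (5 / 2) α a b X X') ∧
    (∀ α ∈ Icc (11/5 : ℝ) (28/5), ∃ a b : ℝ, ∃ X X' : ℝ → ℝ, UnstableWitness 3 α a b X X') :=
  ⟨fun _ h => unstable_from_lensLo_half h.1 h.2, fun _ h => unstable_from_lensLo_threeQuarters h.1 h.2, fun _ h => unstable_from_lensLo_one h.1 h.2, fun _ h => unstable_from_lensLo_fiveQuarters h.1 h.2, fun _ h => unstable_from_lensLo_threeHalves h.1 h.2, fun _ h => unstable_from_lensLo_two h.1 h.2, fun _ h => unstable_from_lensLo_fiveHalves h.1 h.2,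
    fun _ h => unstable_from_lensLo_three h.1 h.2⟩

/-- … in particular none of these `α` is on the stable side (`StableSide s α` fails throughout the eight intervals). [cite: Freidberg2014, §12.3 eq. (12.40)] -/
theorem not_stableSide_three {α : ℝ} (h1 : (11/5 : ℝ) ≤ α) (h2 : α ≤ 28/5) : ¬ StableSide 3 α := by
  obtain ⟨a, b, X, X', hw⟩ := unstable_from_lensLo_three h1 h2
  exact fun hs => hs a b X X' hw

end SAlphaSecondEdgeBands

end Summit.Ventures.FusionMHD.Bench
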